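import Literature.Topology.FourManifolds.SimplyConnectedCobordismStabilisation
import Literature.Topology.FourManifolds.CobordismTwoThreeSimplyConnected
import HarnessLib

/-!
# The level above the 2-handles of a cobordism from a simply connected 4-manifold with stably
# framed interior is a stabilisation of the incoming end (one-sided middle level)

Topic `Literature/Topology/FourManifolds`.  Prove-seat of Wall's theorem
`Literature.Topology.FourManifolds.isHCobordant_of_equivalent_intersectionForm` (Wall 1964,
Thm. 2), groundwork for its parity step C4 (Kirby 1989, Ch. II §4 / Lemma 4.1: for a simply
connected closed 4-manifold all of whose sphere maps are stably tangent-framed the intersection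
form is even), which will be read on the level `M_{1/2}` of the punctured cylinder
`X × I ∖ B⁵` viewed as a cobordism from `S⁴`.  For that cobordism only the INCOMING end is simply
connected, so the two-sided middle-level theorems of the tree
(`Cobordism.exists_middleLevel_isStabilization_twoSided_of_isEven_interior`, both ends simply
connected, nice 2/3 Morse functions) do not apply; this file proves the one-sided statement:

* `Cobordism.IsNiceMorseFunction.isStabilization_middleLevel_of_step_of_two_le` — the chain of
  `Cobordism.IsNiceMorseFunction.isStabilization_middleLevel_of_step` (`CobordismLevelChain.lean`)
  for a nice Morse function all of whose critical points have index `≥ 2` (instead of `2` or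
  `3`): the level `g⁻¹(1/2)` lies above the index-2 critical points (value `5/12`) and below all
  others (values `≥ 7/12`), and is a `#Crit₂`-fold stabilisation of `X₁` under the passage
  hypothesis `hstep` (proof verbatim, the perturbation of Milnor's Lemma 2.8 included);
* `Cobordism.exists_middleLevel_isStabilization_left_of_isEven_interior` — **for a cobordism
  `(W; X₁, X₂)` of dimension 5 with `W` and `X₁` simply connected (no hypothesis on `X₂`) whose
  interior is stably framed along every map `S² → W♭`, there is a nice Morse function with all
  critical points of index `≥ 2` whose level `g⁻¹(1/2)`, a closed smooth 4-manifold `N`, is a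
  `#Crit₂`-fold stabilisation `X₁ # k(S² × S²)`** — Milnor's Thm. 8.1 at the incoming end
  (`Cobordism.exists_isMorseFunction_two_le_index_left_of_simplyConnectedSpace`), the final
  rearrangement (`Cobordism.Milnor1965_finalRearrangement_holds`), the level presentation
  (`Cobordism.IsMorseFunction.exists_isSmoothEmbedding_range_eq`) and the passages
  `Cobordism.isConnectedSum_levels_of_isEven_interior` (Kirby 1989 p. 55, *"The framing is zero …
  because `W` is spin"*).

Everything is proved; no definitions, no named facts.

## References

* R. C. Kirby, *The topology of 4-manifolds*, LNM 1374 (1989), Ch. VIII p. 50, Ch. X p. 55.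
  [Kirby1989]
* J. Milnor, *Lectures on the h-cobordism theorem* (1965), Lemma 2.8, Thm. 4.8, Thm. 8.1, proof of
  Thm. 9.1 (PDF pp. 11, 25, 54, 57). [MilnorHCobordism1965]
-/

open scoped Manifold ContDiff Topology
open Set Function

noncomputable section

namespace Literature.Topology.FourManifolds

/-- Local notation: the unit `2`-sphere. -/
local notation "𝕊²" => (Metric.sphere (0 : EuclideanSpace ℝ (Fin (2 + 1))) 1)

section Chain

variable {X₁ X₂ : Type} [TopologicalSpace X₁] [T2Space X₁] [SecondCountableTopology X₁]
  [ChartedSpace (EuclideanSpace ℝ (Fin 4)) X₁] [IsManifold (𝓡 4) ∞ X₁] [CompactSpace X₁] [SimplyConnectedSpace X₁]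
  [TopologicalSpace X₂] [T2Space X₂] [SecondCountableTopology X₂]
  [ChartedSpace (EuclideanSpace ℝ (Fin 4)) X₂] [IsManifold (𝓡 4) ∞ X₂] [CompactSpace X₂]

omit [T2Space X₁] [SecondCountableTopology X₁] [CompactSpace X₁] [SimplyConnectedSpace X₁] [T2Space X₂]
  [SecondCountableTopology X₂] [IsManifold (𝓡 4) ∞ X₂] [CompactSpace X₂] in
/-- **The one-sided middle-level chain for a nice Morse function with critical points of index
`≥ 2`** (as `Cobordism.IsNiceMorseFunction.isStabilization_middleLevel_of_step`, whose proof is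
repeated verbatim: the index-2 critical values `5/12` are made distinct by a perturbation of size
`< 1/48` supported away from the level `1/2`, Milnor's Lemma 2.8; all other critical values are
`≥ 7/12`; then `Cobordism.IsMorseFunction.isStabilization_level_of_step` at `b = 1/2`).
[cite: Kirby1989, Ch. VIII p. 50, Ch. X p. 55] [cite: MilnorHCobordism1965, Lemma 2.8 (PDF p. 11), §3 p. 21] -/
theorem Cobordism.IsNiceMorseFunction.isStabilization_middleLevel_of_step_of_two_le {c : Cobordism 4 X₁ X₂}
    (hstep : ∀ (g : c.W → ℝ) (q : c.W) (b b₂ : ℝ)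
      (V : Type) [TopologicalSpace V] [T2Space V] [ChartedSpace (EuclideanSpace ℝ (Fin 4)) V] [IsManifold (𝓡 4) ∞ V] (ι : V → c.W)
      (V₂ : Type) [TopologicalSpace V₂] [T2Space V₂] [ChartedSpace (EuclideanSpace ℝ (Fin 4)) V₂] [IsManifold (𝓡 4) ∞ V₂] (ι₂ : V₂ → c.W),
      c.IsMorseFunction g → q ∈ criticalSetOfIndex (𝓡∂ (4 + 1)) g 2 →
      0 < b → b < g q → g q < b₂ → b₂ < 1 →
      (∀ z ∈ criticalSet (𝓡∂ (4 + 1)) g, g z ∈ Icc b b₂ → z = q) →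
      (∀ z ∈ criticalSet (𝓡∂ (4 + 1)) g, g z < b → morseIndex (𝓡∂ (4 + 1)) g z = 2) →
      Manifold.IsSmoothEmbedding (𝓡 4) (𝓡∂ (4 + 1)) ∞ ι → range ι = g ⁻¹' {b} →
      Manifold.IsSmoothEmbedding (𝓡 4) (𝓡∂ (4 + 1)) ∞ ι₂ → range ι₂ = g ⁻¹' {b₂} →
      IsConnectedSum (𝓡 4) (𝓡 4) ((𝓡 2).prod (𝓡 2)) V (𝕊² × 𝕊²) V₂)
    {g : c.W → ℝ} (hg : c.IsNiceMorseFunction g)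
    (h2 : ∀ z, IsMCriticalPt (𝓡∂ (4 + 1)) g z → 2 ≤ morseIndex (𝓡∂ (4 + 1)) g z)
    (N : Type) [TopologicalSpace N] [T2Space N] [ChartedSpace (EuclideanSpace ℝ (Fin 4)) N] [IsManifold (𝓡 4) ∞ N]
    (e : N → c.W) (he : Manifold.IsSmoothEmbedding (𝓡 4) (𝓡∂ (4 + 1)) ∞ e) (her : range e = g ⁻¹' {2⁻¹}) :
    IsStabilization (criticalSetOfIndex (𝓡∂ (4 + 1)) g 2).ncard X₁ N := by
  classical
  have hgM : c.IsMorseFunction g := hg.isMorseFunction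
  have hgc : Continuous g := hgM.isMorse.contMDiff.continuous
  -- the values of the critical points of the nice function
  have hval : ∀ z ∈ criticalSet (𝓡∂ (4 + 1)) g,
      (morseIndex (𝓡∂ (4 + 1)) g z = 2 ∧ g z = 5 / 12) ∨ (3 ≤ morseIndex (𝓡∂ (4 + 1)) g z ∧ 7 / 12 ≤ g z) := by
    intro z hz
    have hv := hg.2 z hz
    rcases (h2 z hz).eq_or_lt with h | h
    · left; rw [hv, ← h, Cobordism.niceLevel_four_two]; exact ⟨rfl, rfl⟩
    · right
      refine ⟨h, ?_⟩
      rw [hv, ← Cobordism.niceLevel_four_three]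
      exact (Cobordism.niceLevel_strictMono 4).monotone h
  -- separate the critical values away from the middle level (Lemma 2.8, local form)
  set O : Set c.W := g ⁻¹' Iio (11 / 24) ∪ g ⁻¹' Ioi (13 / 24) with hOdef
  have hO : IsOpen O := (isOpen_Iio.preimage hgc).union (isOpen_Ioi.preimage hgc)
  have hOc : criticalSet (𝓡∂ (4 + 1)) g ⊆ O := fun z hz => by
    rcases hval z hz with ⟨-, h⟩ | ⟨-, h⟩
    · left; show g z < 11 / 24; rw [h]; norm_num
    · right; show 13 / 24 < g z; linarith
  obtain ⟨g', hg', hcrit, hidx, hoff, hsmall, hinj⟩ :=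
    hgM.exists_injOn_local hO hOc (δ := 1 / 48) (by norm_num)
  have hmemg : ∀ {z}, z ∈ criticalSet (𝓡∂ (4 + 1)) g' ↔ z ∈ criticalSet (𝓡∂ (4 + 1)) g := fun {z} => by
    rw [hcrit]
  -- values of `g'` at the critical points
  have hval' : ∀ z ∈ criticalSet (𝓡∂ (4 + 1)) g',
      (morseIndex (𝓡∂ (4 + 1)) g' z = 2 ∧ g' z < 2⁻¹) ∨ (3 ≤ morseIndex (𝓡∂ (4 + 1)) g' z ∧ 2⁻¹ < g' z) := by
    intro z hz'
    have hz : z ∈ criticalSet (𝓡∂ (4 + 1)) g := hmemg.1 hz'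
    have hs := abs_lt.1 (hsmall z)
    rcases hval z hz with ⟨hi, hv⟩ | ⟨hi, hv⟩
    · left; refine ⟨by rw [hidx z hz, hi], ?_⟩; rw [hv] at hs; norm_num at hs ⊢; linarith [hs.2]
    · right; refine ⟨by rw [hidx z hz]; exact hi, ?_⟩; norm_num at hs ⊢; linarith [hs.1]
  -- the middle level is unchanged
  have hlevel : g' ⁻¹' {2⁻¹} = g ⁻¹' {2⁻¹} := by
    ext z
    simp only [mem_preimage, mem_singleton_iff]
    by_cases hzO : z ∈ O
    · have hs := abs_lt.1 (hsmall z)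
      rcases hzO with h | h
      · have h' : g z < 11 / 24 := h
        constructor
        · intro h1; exfalso; norm_num at hs h1; linarith [hs.2]
        · intro h1; exfalso; norm_num at h1; linarith
      · have h' : 13 / 24 < g z := h
        constructor
        · intro h1; exfalso; norm_num at hs h1; linarith [hs.1]
        · intro h1; exfalso; norm_num at h1; linarith
    · rw [hoff z hzO]
  -- the chain at `b = 1/2`
  have hreg : ∀ z ∈ criticalSet (𝓡∂ (4 + 1)) g', g' z ≠ 2⁻¹ := fun z hz h => by
    rcases hval' z hz with ⟨-, hlt⟩ | ⟨-, hgt⟩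
    · exact hlt.ne h
    · exact hgt.ne' h
  have hidx2 : ∀ z ∈ criticalSet (𝓡∂ (4 + 1)) g', g' z < 2⁻¹ → morseIndex (𝓡∂ (4 + 1)) g' z = 2 := fun z hz hzb => by
    rcases hval' z hz with ⟨h2', -⟩ | ⟨-, hgt⟩
    · exact h2'
    · exact absurd hzb (not_lt.2 hgt.le)
  have hinj' : InjOn g' {z | z ∈ criticalSet (𝓡∂ (4 + 1)) g' ∧ g' z < 2⁻¹} := fun z hz w hw h =>
    hinj (hmemg.1 hz.1) (hmemg.1 hw.1) h
  have hchain := hg'.isStabilization_level_of_step hstep (b := 2⁻¹) (by norm_num) (by norm_num) hreg hidx2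
    hinj' N e he (by rw [her, hlevel])
  -- the count: the critical points of `g'` below `1/2` are the index-2 critical points of `g`
  have hset : {z | z ∈ criticalSet (𝓡∂ (4 + 1)) g' ∧ g' z < 2⁻¹} = criticalSetOfIndex (𝓡∂ (4 + 1)) g 2 := by
    ext z
    simp only [mem_setOf_eq, mem_criticalSetOfIndex]
    constructor
    · rintro ⟨hz', hzb⟩
      have hz : z ∈ criticalSet (𝓡∂ (4 + 1)) g := hmemg.1 hz'
      exact ⟨hz, by rw [← hidx z hz]; exact hidx2 z hz' hzb⟩
    · rintro ⟨hz, h2'⟩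
      have hz' : z ∈ criticalSet (𝓡∂ (4 + 1)) g' := hmemg.2 hz
      refine ⟨hz', ?_⟩
      rcases hval' z hz' with ⟨-, hlt⟩ | ⟨h3, -⟩
      · exact hlt
      · rw [hidx z hz, h2'] at h3; exact absurd h3 (by norm_num)
  rw [hset] at hchain
  exact hchain

/-- **One-sided middle level for a simply connected cobordism from a simply connected 4-manifold
with stably framed interior** (Kirby 1989, Ch. VIII p. 50 / Ch. X p. 55, at the incoming end
only): for `c = (W; X₁, X₂)`, `dim W = 5`, with `W`, `X₁` simply connected, `X₂` nonempty, and
`TW♭ ⊕ ℝ` framed along every `S² → W♭`, there are a nice Morse function `g` all of whose critical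
points have index `≥ 2` and a closed smooth 4-manifold `N` presenting the level `g⁻¹(1/2)` which
is a `#Crit₂(g)`-fold stabilisation of `X₁`.  Proof: a Morse function (Thm. 2.5), Milnor's
Thm. 8.1 at the incoming end (`H₀(W, X₁) = 0` since `W` is path connected), the final
rearrangement (Thm. 4.8), the level presentation, and the chain with the untwisted passages
`Cobordism.isConnectedSum_levels_of_isEven_interior`.
[cite: Kirby1989, Ch. VIII p. 50, Ch. X p. 55] [cite: MilnorHCobordism1965, Thm. 2.5, Thm. 4.8, Thm. 8.1 (PDF pp. 25, 54)] -/
theorem Cobordism.exists_middleLevel_isStabilization_left_of_isEven_interior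
    (c : Cobordism 4 X₁ X₂) [Nonempty X₂] (hW : SimplyConnectedSpace c.W)
    (heven : ∀ T : C(𝕊², PassageSetting.Wb c),
      HasStableTangentFramingAlong (𝓡 (4 + 1)) (PassageSetting.Wb c) T) :
    ∃ (g : c.W → ℝ) (N : Type) (_ : TopologicalSpace N) (_ : T2Space N) (_ : SecondCountableTopology N)
      (_ : ChartedSpace (EuclideanSpace ℝ (Fin 4)) N) (_ : CompactSpace N) (_ : IsManifold (𝓡 4) ∞ N)
      (e : N → c.W),
      c.IsNiceMorseFunction g ∧
      (∀ z, IsMCriticalPt (𝓡∂ (4 + 1)) g z → 2 ≤ morseIndex (𝓡∂ (4 + 1)) g z) ∧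
      Manifold.IsSmoothEmbedding (𝓡 4) (𝓡∂ (4 + 1)) ∞ e ∧ range e = g ⁻¹' {2⁻¹} ∧
      IsStabilization (criticalSetOfIndex (𝓡∂ (4 + 1)) g 2).ncard X₁ N := by
  haveI := hW
  -- Thm. 2.5: a Morse function on the triad
  obtain ⟨f₀, hf₀⟩ := Cobordism.exists_isMorseFunction_holds (n := 4) (M := X₁) (N := X₂) c
  -- Thm. 8.1 at the incoming end
  haveI : PathConnectedSpace c.W := inferInstance
  have hH0 : ∀ z : c.W, ∃ x : X₁, Joined z (c.inl x) := fun z =>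
    c.exists_joined_inl_of_pathConnectedSpace z
  obtain ⟨f₁, hf₁, hidx₁, -⟩ :=
    c.exists_isMorseFunction_two_le_index_left_of_simplyConnectedSpace le_rfl hW ‹_› hH0 f₀ hf₀
  -- Thm. 4.8: a nice function with the same critical points and indices
  obtain ⟨g, hg, hcrit, hind⟩ := Cobordism.Milnor1965_finalRearrangement_holds hf₁
  have h2 : ∀ z, IsMCriticalPt (𝓡∂ (4 + 1)) g z → 2 ≤ morseIndex (𝓡∂ (4 + 1)) g z := by
    intro z hz
    have hz' : z ∈ criticalSet (𝓡∂ (4 + 1)) f₁ := by rw [← hcrit]; exact hz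
    rw [hind z hz']
    exact hidx₁ z hz'
  -- the level `1/2` is regular
  have hreg : ∀ z, IsMCriticalPt (𝓡∂ (4 + 1)) g z → g z ≠ 2⁻¹ := by
    intro z hz hz'
    have hv := hg.2 z hz
    rcases (h2 z hz).eq_or_lt with h | h
    · rw [hv, ← h, Cobordism.niceLevel_four_two] at hz'; norm_num at hz'
    · have h7 : (7 : ℝ) / 12 ≤ g z := by
        rw [hv, ← Cobordism.niceLevel_four_three]
        exact (Cobordism.niceLevel_strictMono 4).monotone h
      rw [hz'] at h7; norm_num at h7
  obtain ⟨N, _, _, _, _, _, _, e, he, hrange⟩ :=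
    hg.isMorseFunction.exists_isSmoothEmbedding_range_eq ⟨by norm_num, by norm_num⟩ hreg
  refine ⟨g, N, ‹_›, ‹_›, ‹_›, ‹_›, ‹_›, ‹_›, e, hg, h2, he, hrange, ?_⟩
  exact hg.isStabilization_middleLevel_of_step_of_two_le
    (fun _ _ _ _ V _ _ _ _ ι V₂ _ _ _ _ ι₂ hg hq hb hbq hqb₂ hb₂ honly hidx hι hιr hι₂ hι₂r =>
      Cobordism.isConnectedSum_levels_of_isEven_interior hg heven hq hb hbq hqb₂ hb₂ honly hidx V ι hι
        hιr V₂ ι₂ hι₂ hι₂r)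
    h2 N e he hrange

end Chain

end Literature.Topology.FourManifolds

end
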